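import Literature.Geometry.Riemannian.MeanConvexShearFlow
import Literature.Topology.FourManifolds.EuclideanMorseCharts
import Mathlib.Geometry.Manifold.PartitionOfUnity
import Mathlib.Topology.MetricSpace.Thickening
import Mathlib.Analysis.InnerProductSpace.Dual
import Mathlib.Analysis.InnerProductSpace.Calculus

/-!
# The orthogonalising shear for the handles of the surrounding construction

Topic `Geometry/Riemannian` (fact seat
`provefact-Literature.Geometry.Riemannian.LawsonMichelsohn1984_surrounding`).  Everything here
is **proved**; no definitions.

First step of Lawson–Michelsohn's handle theorem (Thm. 3.1) in the explicit Euclidean form used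
by the fact: the descending discs `D_p = e_p⁻¹{y⃗ = 0, |x⃗|² ≤ ε}` of the Morse charts hang on
the mean-convex level `Σ = {f = c - ε}` along the spheres `S_p = e_p⁻¹{y⃗ = 0, |x⃗|² = ε}`, and
*"by a small perturbation we may assume that `Dᵖ` meets `∂X` orthogonally"*.  The perturbation is
the level-preserving shear `Λ` of `MeanConvexShearFlow.exists_shear_diffeomorph` for the field
`B = ∑_p χ_p (V_p + ∇f/‖∇f‖²)`, where `V_p = De_p⁻¹(x⃗, 0)/(2|x⃗|²)` has `df(V_p) = -1` on the chart
domain (Milnor's normal form) and `df(∇f/‖∇f‖²) = 1`, so that `df(B) = 0` exactly: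

* `exists_orthogonalising_shear` — a `C^∞` diffeomorphism `Λ` with `f ∘ Λ = f`, `Λ = id` on
  `{f = c - ε}` and off `U`, `Λ p = p`, and along each `S_p`
  `D(Λ ∘ e_p⁻¹)(y)(y - mv(y)) = -(4ε/‖∇f‖²) ∇f` (`y - mv(y) = (2x⃗, 0)`): the sheared discs
  `Λ(D_p)` contain the normal direction of `Σ` along `S_p`.

## References

* H. B. Lawson, Jr., M.-L. Michelsohn, *Embedding and surrounding with positive mean curvature*,
  Invent. Math. 77 (1984), proof of Thm. 3.1. [LawsonMichelsohn1984]
* J. Milnor, *Lectures on the h-cobordism theorem* (1965), Def. 3.1. [MilnorHCobordism1965]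
-/

noncomputable section

open Set Function Filter Metric Module
open scoped Topology Manifold ContDiff RealInnerProductSpace

namespace Literature.Geometry.Riemannian

open Literature.Topology.FourManifolds

/-! ### Cut-off products with locally defined fields -/

section Cutoff

variable {E F : Type*} [NormedAddCommGroup E] [NormedSpace ℝ E] [NormedAddCommGroup F]
  [NormedSpace ℝ F] {n' : WithTop ℕ∞}

/-- If `V` is `C^n` on the open set `O`, `χ` is `C^n` and the support of `χ` lies in `O`, then
`χ • V` is `C^n` (a private copy of the tree's `OneFormChartCompactness` lemma, to keep the
imports light). [folklore] -/
private theorem contDiff_smul_of_tsupport_subset_aux {χ : E → ℝ} {V : E → F} {O : Set E} (hO : IsOpen O)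
    (hV : ContDiffOn ℝ n' V O) (hχ : ContDiff ℝ n' χ) (hsupp : tsupport χ ⊆ O) :
    ContDiff ℝ n' fun z => χ z • V z := by
  refine contDiff_iff_contDiffAt.2 fun z => ?_
  by_cases hz : z ∈ O
  · exact hχ.contDiffAt.smul (hV.contDiffAt (hO.mem_nhds hz))
  · have hz' : z ∉ tsupport χ := fun h => hz (hsupp h)
    have hev : (fun z => χ z • V z) =ᶠ[𝓝 z] fun _ => 0 := by
      filter_upwards [(isClosed_tsupport χ).isOpen_compl.mem_nhds hz'] with y hy
      rw [image_eq_zero_of_notMem_tsupport hy, zero_smul]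
    exact contDiffAt_const.congr_of_eventuallyEq hev

omit [NormedSpace ℝ E] in
/-- The support of `χ • V` lies in the support of `χ`. [folklore] -/
theorem tsupport_smul_subset_left' (χ : E → ℝ) (V : E → F) :
    tsupport (fun z => χ z • V z) ⊆ tsupport χ :=
  closure_mono fun z hz => by
    rw [mem_support] at hz ⊢
    exact fun h => hz (by rw [h, zero_smul])

end Cutoff

/-! ### Milnor's normal form: derivatives in the chart -/

section Chart

variable {n : ℕ}

/-- The coordinates of `y - mv(y) = (2x⃗, 0)`. [folklore] -/
theorem sub_milnorModelField_apply (k : ℕ) (y : EuclideanSpace ℝ (Fin n)) (i : Fin n) :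
    (y - milnorModelField k y) i = if (i : ℕ) < k then 2 * y i else 0 := by
  rw [show (y - milnorModelField k y) i = y i - milnorModelField k y i from rfl,
    milnorModelField_apply]
  split_ifs <;> ring

/-- **The derivative of `f` in a Milnor chart on `(2x⃗, 0)`**: if `f ∘ e⁻¹ = c - |x⃗|² + |y⃗|²`
on the (open) target, then `d(f ∘ e⁻¹)(y)(y - mv(y)) = -4 |x⃗|²`. [cite: MilnorHCobordism1965, Def. 3.1] -/
theorem hasFDerivAt_comp_symm_milnor {f : EuclideanSpace ℝ (Fin n) → ℝ} {c : ℝ} {k : ℕ}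
    (e : OpenPartialHomeomorph (EuclideanSpace ℝ (Fin n)) (EuclideanSpace ℝ (Fin n)))
    (hquad : ∀ y ∈ e.target, f (e.symm y) = c - sqSumLT k y + sqSumGE k y)
    {y : EuclideanSpace ℝ (Fin n)} (hy : y ∈ e.target) :
    HasFDerivAt (f ∘ e.symm)
      (-(∑ i ∈ Finset.univ.filter (fun i : Fin n => (i : ℕ) < k),
          (2 * y i) • (EuclideanSpace.proj (𝕜 := ℝ) i)) +
        ∑ i ∈ Finset.univ.filter (fun i : Fin n => k ≤ (i : ℕ)),
          (2 * y i) • (EuclideanSpace.proj (𝕜 := ℝ) i)) y := by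
  have hmodel : HasFDerivAt (fun u : EuclideanSpace ℝ (Fin n) => c - sqSumLT k u + sqSumGE k u)
      (-(∑ i ∈ Finset.univ.filter (fun i : Fin n => (i : ℕ) < k),
          (2 * y i) • (EuclideanSpace.proj (𝕜 := ℝ) i)) +
        ∑ i ∈ Finset.univ.filter (fun i : Fin n => k ≤ (i : ℕ)),
          (2 * y i) • (EuclideanSpace.proj (𝕜 := ℝ) i)) y := by
    have h1 := hasFDerivAt_sum_sq (Finset.univ.filter (fun i : Fin n => (i : ℕ) < k)) y
    have h2 := hasFDerivAt_sum_sq (Finset.univ.filter (fun i : Fin n => k ≤ (i : ℕ))) y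
    exact (h1.const_sub c).add h2
  refine hmodel.congr_of_eventuallyEq ?_
  filter_upwards [e.open_target.mem_nhds hy] with u hu
  exact hquad u hu

/-- Evaluation: `d(f ∘ e⁻¹)(y)(y - mv(y)) = -4 |x⃗|²`. [cite: MilnorHCobordism1965, Def. 3.1] -/
theorem fderiv_comp_symm_sub_milnorModelField {f : EuclideanSpace ℝ (Fin n) → ℝ} {c : ℝ} {k : ℕ}
    (e : OpenPartialHomeomorph (EuclideanSpace ℝ (Fin n)) (EuclideanSpace ℝ (Fin n)))
    (hquad : ∀ y ∈ e.target, f (e.symm y) = c - sqSumLT k y + sqSumGE k y)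
    {y : EuclideanSpace ℝ (Fin n)} (hy : y ∈ e.target) :
    fderiv ℝ (f ∘ e.symm) y (y - milnorModelField k y) = -4 * sqSumLT k y := by
  rw [(hasFDerivAt_comp_symm_milnor e hquad hy).fderiv]
  show -((∑ i ∈ Finset.univ.filter (fun i : Fin n => (i : ℕ) < k),
          (2 * y i) • (EuclideanSpace.proj (𝕜 := ℝ) i)) (y - milnorModelField k y)) +
      (∑ i ∈ Finset.univ.filter (fun i : Fin n => k ≤ (i : ℕ)),
          (2 * y i) • (EuclideanSpace.proj (𝕜 := ℝ) i)) (y - milnorModelField k y) = _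
  simp only [FunLike.coe_sum, Finset.sum_apply, FunLike.coe_smul, Pi.smul_apply,
    EuclideanSpace.coe_proj, smul_eq_mul, sub_milnorModelField_apply, sqSumLT, Finset.mul_sum]
  have h1 : ∑ i ∈ Finset.univ.filter (fun i : Fin n => (i : ℕ) < k),
      2 * y i * (if (i : ℕ) < k then 2 * y i else 0) =
      ∑ i ∈ Finset.univ.filter (fun i : Fin n => (i : ℕ) < k), 4 * y i ^ 2 := by
    refine Finset.sum_congr rfl fun i hi => ?_
    rw [Finset.mem_filter] at hi
    rw [if_pos hi.2]; ring
  have h2 : ∑ i ∈ Finset.univ.filter (fun i : Fin n => k ≤ (i : ℕ)),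
      2 * y i * (if (i : ℕ) < k then 2 * y i else 0) = 0 := by
    refine Finset.sum_eq_zero fun i hi => ?_
    rw [Finset.mem_filter] at hi
    rw [if_neg (not_lt.2 hi.2)]; ring
  rw [h1, h2, add_zero, ← Finset.sum_neg_distrib]
  exact Finset.sum_congr rfl fun i _ => by ring

end Chart

/-! ### The gradient as a basis sum -/

section Gradient

variable {n : ℕ}

/-- The Riesz vector of `df(z)` expanded in the standard orthonormal basis:
`∑ᵢ df(z)(bᵢ) bᵢ = ∇f(z)`. [folklore] -/
theorem sum_fderiv_apply_smul_eq_toDual_symm (ℓ : EuclideanSpace ℝ (Fin n) →L[ℝ] ℝ) :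
    ∑ i, ℓ (EuclideanSpace.basisFun (Fin n) ℝ i) • EuclideanSpace.basisFun (Fin n) ℝ i =
      (InnerProductSpace.toDual ℝ (EuclideanSpace ℝ (Fin n))).symm ℓ := by
  set g := (InnerProductSpace.toDual ℝ (EuclideanSpace ℝ (Fin n))).symm ℓ with hg
  have hℓ : ∀ w, ℓ w = ⟪g, w⟫ := fun w => by rw [hg, InnerProductSpace.toDual_symm_apply]
  have h := (EuclideanSpace.basisFun (Fin n) ℝ).sum_repr' g
  conv_rhs => rw [← h]
  refine Finset.sum_congr rfl fun i _ => ?_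
  rw [hℓ, real_inner_comm]

/-- `df(z)(∇f(z)) = ‖∇f(z)‖²`. [folklore] -/
theorem apply_toDual_symm_self (ℓ : EuclideanSpace ℝ (Fin n) →L[ℝ] ℝ) :
    ℓ ((InnerProductSpace.toDual ℝ (EuclideanSpace ℝ (Fin n))).symm ℓ) =
      ‖(InnerProductSpace.toDual ℝ (EuclideanSpace ℝ (Fin n))).symm ℓ‖ ^ 2 := by
  rw [← InnerProductSpace.toDual_symm_apply (x := (InnerProductSpace.toDual ℝ _).symm ℓ) (y := ℓ),
    real_inner_self_eq_norm_sq]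

end Gradient

/-! ### The shear -/

section Shear

variable {n : ℕ}

set_option maxHeartbeats 1600000 in
/-- **The orthogonalising shear.**  Let `f` be `C^∞` on `ℝⁿ`, regular on the level
`{f = c - ε}`, with Milnor charts `e_p` (`p ∈ P`) as in the handle theorem (normal form
`f ∘ e_p⁻¹ = c - |x⃗|² + |y⃗|²` on the target, `B̄(0, R) ⊆ target`, `2ε ≤ R²`, pairwise disjoint
chart balls), and let `U` be an open set containing the attaching spheres
`S_p = e_p⁻¹{y⃗ = 0, |x⃗|² = ε}`.  Then there is a `C^∞` diffeomorphism `Λ` of `ℝⁿ` with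
`f ∘ Λ = f`, `Λ = id` on `{f = c - ε}`, `Λ = id = Λ⁻¹` off `U` and at the points `p`, and, for
`y ∈ {y⃗ = 0, |x⃗|² = ε}`, `D(Λ ∘ e_p⁻¹)(y)(y - mv(y)) = -(4ε/‖∇f(s)‖²) ∇f(s)`, `s = e_p⁻¹ y`:
the sheared disc `Λ(e_p⁻¹{y⃗ = 0})` contains the normal of `{f = c - ε}` at `s`.
[cite: LawsonMichelsohn1984, proof of Thm. 3.1] -/
theorem exists_orthogonalising_shear {f : EuclideanSpace ℝ (Fin n) → ℝ} (hf : ContDiff ℝ ∞ f)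
    {c ε R : ℝ} (hε : 0 < ε) (hR : 0 < R) (hεR : 2 * ε ≤ R ^ 2)
    (P : Finset (EuclideanSpace ℝ (Fin n))) (lam : EuclideanSpace ℝ (Fin n) → ℕ)
    (e : EuclideanSpace ℝ (Fin n) →
      OpenPartialHomeomorph (EuclideanSpace ℝ (Fin n)) (EuclideanSpace ℝ (Fin n)))
    (he : ∀ p ∈ P, e p ∈ IsManifold.maximalAtlas (𝓡 n) ∞ (EuclideanSpace ℝ (Fin n)))
    (hpe : ∀ p ∈ P, p ∈ (e p).source ∧ e p p = 0)
    (hball : ∀ p ∈ P, closedBall (0 : EuclideanSpace ℝ (Fin n)) R ⊆ (e p).target)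
    (hquad : ∀ p ∈ P, ∀ y ∈ (e p).target,
      f ((e p).symm y) = c - sqSumLT (lam p) y + sqSumGE (lam p) y)
    (hdisj : ∀ p ∈ P, ∀ p' ∈ P, p ≠ p' →
      Disjoint ((e p).symm '' closedBall (0 : EuclideanSpace ℝ (Fin n)) R)
        ((e p').symm '' closedBall (0 : EuclideanSpace ℝ (Fin n)) R))
    (hreg : ∀ x, f x = c - ε → fderiv ℝ f x ≠ 0) {U : Set (EuclideanSpace ℝ (Fin n))}
    (hU : IsOpen U)
    (hSU : ∀ p ∈ P, ∀ y : EuclideanSpace ℝ (Fin n), (∀ i : Fin n, lam p ≤ i.val → y i = 0) →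
      sqSumLT (lam p) y = ε → (e p).symm y ∈ U) :
    ∃ Λ : EuclideanSpace ℝ (Fin n) ≃ₘ⟮𝓘(ℝ, EuclideanSpace ℝ (Fin n)),
        𝓘(ℝ, EuclideanSpace ℝ (Fin n))⟯ EuclideanSpace ℝ (Fin n),
      (∀ z, f (Λ z) = f z) ∧ (∀ z, f z = c - ε → Λ z = z) ∧
      (∀ z, z ∉ U → Λ z = z ∧ Λ.symm z = z) ∧ (∀ p ∈ P, Λ p = p ∧ Λ.symm p = p) ∧
      ∀ p ∈ P, ∀ y : EuclideanSpace ℝ (Fin n), (∀ i : Fin n, lam p ≤ i.val → y i = 0) →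
        sqSumLT (lam p) y = ε →
        fderiv ℝ (Λ ∘ (e p).symm) y (y - milnorModelField (lam p) y) =
          -(4 * ε / ‖(InnerProductSpace.toDual ℝ (EuclideanSpace ℝ (Fin n))).symm
              (fderiv ℝ f ((e p).symm y))‖ ^ 2) •
            (InnerProductSpace.toDual ℝ (EuclideanSpace ℝ (Fin n))).symm
              (fderiv ℝ f ((e p).symm y)) := by
  classical
  -- ### smoothness of the charts
  have hsymm : ∀ p ∈ P, ContDiffOn ℝ ∞ (e p).symm (e p).target := fun p hp =>
    contMDiffOn_iff_contDiffOn.1 (contMDiffOn_symm_of_mem_maximalAtlas (he p hp))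
  have hfwd : ∀ p ∈ P, ContDiffOn ℝ ∞ (e p) (e p).source := fun p hp =>
    contMDiffOn_iff_contDiffOn.1 (contMDiffOn_of_mem_maximalAtlas (he p hp))
  have hfd : Differentiable ℝ f := hf.differentiable (by simp)
  have hfcont : Continuous (fderiv ℝ f) := hf.continuous_fderiv (by simp)
  -- the spheres `S̃_p` in the model and their images
  have hSball : ∀ p ∈ P, ∀ y : EuclideanSpace ℝ (Fin n), (∀ i : Fin n, lam p ≤ i.val → y i = 0) →
      sqSumLT (lam p) y = ε → y ∈ ball (0 : EuclideanSpace ℝ (Fin n)) R ∧ y ∈ (e p).target := by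
    intro p hp y hy0 hyξ
    have hη : sqSumGE (lam p) y = 0 :=
      Finset.sum_eq_zero fun i hi => by rw [Finset.mem_filter] at hi; rw [hy0 i hi.2]; ring
    have hnorm : ‖y‖ ^ 2 = ε := by rw [← sqSumLT_add_sqSumGE (lam p) y, hyξ, hη, add_zero]
    have hyR : ‖y‖ < R := by nlinarith [norm_nonneg y]
    exact ⟨mem_ball_zero_iff.2 hyR, hball p hp (mem_closedBall_zero_iff.2 hyR.le)⟩
  have hfS : ∀ p ∈ P, ∀ y : EuclideanSpace ℝ (Fin n), (∀ i : Fin n, lam p ≤ i.val → y i = 0) →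
      sqSumLT (lam p) y = ε → f ((e p).symm y) = c - ε := by
    intro p hp y hy0 hyξ
    have hη : sqSumGE (lam p) y = 0 :=
      Finset.sum_eq_zero fun i hi => by rw [Finset.mem_filter] at hi; rw [hy0 i hi.2]; ring
    rw [hquad p hp y (hSball p hp y hy0 hyξ).2, hyξ, hη]; ring
  -- ### the open sets `N_p`
  set N : EuclideanSpace ℝ (Fin n) → Set (EuclideanSpace ℝ (Fin n)) := fun p =>
    U ∩ ((e p).source ∩ (e p) ⁻¹' (ball 0 R ∩ {y | ε / 2 < sqSumLT (lam p) y})) ∩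
      {z | fderiv ℝ f z ≠ 0} with hN
  have hNopen : ∀ p ∈ P, IsOpen (N p) := by
    intro p hp
    refine (hU.inter ((e p).isOpen_inter_preimage (isOpen_ball.inter ?_))).inter ?_
    · exact isOpen_lt continuous_const (continuous_sqSumLT _)
    · exact isOpen_ne_fun hfcont continuous_const
  -- the spheres are compact subsets of `N_p`
  set Smodel : EuclideanSpace ℝ (Fin n) → Set (EuclideanSpace ℝ (Fin n)) := fun p =>
    {y | (∀ i : Fin n, lam p ≤ i.val → y i = 0) ∧ sqSumLT (lam p) y = ε} with hSmodel
  set S : EuclideanSpace ℝ (Fin n) → Set (EuclideanSpace ℝ (Fin n)) := fun p =>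
    (e p).symm '' Smodel p with hS
  have hSmodel_closed : ∀ p, IsClosed (Smodel p) := fun p => by
    have h1 : IsClosed {y : EuclideanSpace ℝ (Fin n) | ∀ i : Fin n, lam p ≤ i.val → y i = 0} := by
      have : {y : EuclideanSpace ℝ (Fin n) | ∀ i : Fin n, lam p ≤ i.val → y i = 0} =
          ⋂ i : Fin n, {y | lam p ≤ i.val → y i = 0} := by ext y; simp
      rw [this]
      refine isClosed_iInter fun i => ?_
      by_cases hi : lam p ≤ i.val
      · have : {y : EuclideanSpace ℝ (Fin n) | lam p ≤ i.val → y i = 0} = {y | y i = 0} := by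
          ext y; simp [hi]
        rw [this]
        exact isClosed_eq ((EuclideanSpace.proj (𝕜 := ℝ) i).continuous) continuous_const
      · have : {y : EuclideanSpace ℝ (Fin n) | lam p ≤ i.val → y i = 0} = univ := by
          ext y; simp [hi]
        rw [this]; exact isClosed_univ
    exact h1.inter (isClosed_eq (continuous_sqSumLT _) continuous_const)
  have hSmodel_sub : ∀ p ∈ P, Smodel p ⊆ closedBall (0 : EuclideanSpace ℝ (Fin n)) R :=
    fun p hp y hy => ball_subset_closedBall (hSball p hp y hy.1 hy.2).1
  have hScompact : ∀ p ∈ P, IsCompact (S p) := fun p hp =>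
    ((isCompact_closedBall 0 R).of_isClosed_subset (hSmodel_closed p) (hSmodel_sub p hp)).image_of_continuousOn
      ((hsymm p hp).continuousOn.mono fun y hy => (hSball p hp y hy.1 hy.2).2)
  have hSN : ∀ p ∈ P, S p ⊆ N p := by
    intro p hp z hz
    obtain ⟨y, hy, rfl⟩ := hz
    have hyt := (hSball p hp y hy.1 hy.2).2
    refine ⟨⟨hSU p hp y hy.1 hy.2, (e p).map_target hyt, ?_⟩, hreg _ (hfS p hp y hy.1 hy.2)⟩
    show (e p) ((e p).symm y) ∈ ball 0 R ∩ {y | ε / 2 < sqSumLT (lam p) y}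
    rw [(e p).right_inv hyt]
    exact ⟨(hSball p hp y hy.1 hy.2).1, by show ε / 2 < sqSumLT (lam p) y; rw [hy.2]; linarith⟩
  -- ### the cut-offs
  have hcut : ∀ p ∈ P, ∃ χ : EuclideanSpace ℝ (Fin n) → ℝ, ContDiff ℝ ∞ χ ∧
      (∀ z ∈ S p, χ =ᶠ[𝓝 z] fun _ => 1) ∧ tsupport χ ⊆ N p ∧ HasCompactSupport χ := by
    intro p hp
    obtain ⟨ρ, hρ, hρN⟩ := (hScompact p hp).exists_cthickening_subset_open (hNopen p hp) (hSN p hp)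
    have hint : S p ⊆ interior (cthickening ρ (S p)) :=
      (self_subset_thickening hρ _).trans
        (interior_maximal (thickening_subset_cthickening ρ _) isOpen_thickening)
    obtain ⟨χ, h1, h0, -⟩ := exists_contMDiffMap_one_nhds_of_subset_interior
      𝓘(ℝ, EuclideanSpace ℝ (Fin n)) (n := (⊤ : ℕ∞)) (hScompact p hp).isClosed hint
    have hχc : ContDiff ℝ ∞ χ := contMDiff_iff_contDiff.1 χ.contMDiff
    have hts : tsupport χ ⊆ cthickening ρ (S p) :=
      closure_minimal (fun z hz => by_contra fun h => hz (h0 z h)) (isClosed_cthickening)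
    refine ⟨χ, hχc, fun z hz => ?_, hts.trans hρN, ?_⟩
    · exact (h1.filter_mono (nhds_le_nhdsSet hz))
    · show IsCompact (tsupport χ)
      exact ((hScompact p hp).cthickening).of_isClosed_subset (isClosed_tsupport χ) hts
  choose! χ hχc hχ1 hχN hχcs using hcut
  -- ### the fields `V_p` and `Ξ`
  set b := EuclideanSpace.basisFun (Fin n) ℝ with hb
  set grad : EuclideanSpace ℝ (Fin n) → EuclideanSpace ℝ (Fin n) := fun z =>
    ∑ i, fderiv ℝ f z (b i) • b i with hgrad
  have hgrad_eq : ∀ z, grad z = (InnerProductSpace.toDual ℝ (EuclideanSpace ℝ (Fin n))).symm (fderiv ℝ f z) :=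
    fun z => sum_fderiv_apply_smul_eq_toDual_symm (fderiv ℝ f z)
  have hgradc : ContDiff ℝ ∞ grad := by
    refine ContDiff.sum fun i _ => ?_
    have h1 : ContDiff ℝ ∞ fun z => fderiv ℝ f z (b i) :=
      (hf.fderiv_right (m := ∞) (by simp)).clm_apply contDiff_const
    exact h1.smul contDiff_const
  have hgrad_df : ∀ z, fderiv ℝ f z (grad z) = ‖grad z‖ ^ 2 := fun z => by
    rw [hgrad_eq]; exact apply_toDual_symm_self _
  have hgrad_ne : ∀ z, fderiv ℝ f z ≠ 0 → grad z ≠ 0 := fun z hz h => by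
    apply hz
    rw [hgrad_eq] at h
    exact (InnerProductSpace.toDual ℝ _).symm.injective (by rw [h, map_zero])
  set Ξ : EuclideanSpace ℝ (Fin n) → EuclideanSpace ℝ (Fin n) := fun z => (‖grad z‖ ^ 2)⁻¹ • grad z with hΞ
  have hΞc : ContDiffOn ℝ ∞ Ξ {z | fderiv ℝ f z ≠ 0} := by
    have h1 : ContDiffOn ℝ ∞ (fun z => (‖grad z‖ ^ 2)⁻¹) {z | fderiv ℝ f z ≠ 0} :=
      (hgradc.norm_sq ℝ).contDiffOn.inv fun z hz => pow_ne_zero 2 (norm_ne_zero_iff.2 (hgrad_ne z hz))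
    exact h1.smul hgradc.contDiffOn
  have hΞdf : ∀ z, fderiv ℝ f z ≠ 0 → fderiv ℝ f z (Ξ z) = 1 := fun z hz => by
    rw [hΞ]; dsimp only
    rw [map_smul, hgrad_df, smul_eq_mul,
      inv_mul_cancel₀ (pow_ne_zero 2 (norm_ne_zero_iff.2 (hgrad_ne z hz)))]
  -- `V_p z = (2 |x⃗(e z)|²)⁻¹ • De⁻¹(e z)((1/2)(e z - mv(e z)))`
  set V : EuclideanSpace ℝ (Fin n) → EuclideanSpace ℝ (Fin n) → EuclideanSpace ℝ (Fin n) := fun p z =>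
    (2 * sqSumLT (lam p) (e p z))⁻¹ •
      fderiv ℝ (e p).symm (e p z) ((1 / 2 : ℝ) • (e p z - milnorModelField (lam p) (e p z))) with hV
  have hVc : ∀ p ∈ P, ContDiffOn ℝ ∞ (V p) ((e p).source ∩ (e p) ⁻¹' {y | ε / 2 < sqSumLT (lam p) y}) := by
    intro p hp
    have he_c : ContDiffOn ℝ ∞ (e p) ((e p).source ∩ (e p) ⁻¹' {y | ε / 2 < sqSumLT (lam p) y}) :=
      (hfwd p hp).mono inter_subset_left
    have hmaps : MapsTo (e p) ((e p).source ∩ (e p) ⁻¹' {y | ε / 2 < sqSumLT (lam p) y}) (e p).target :=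
      fun z hz => (e p).map_source hz.1
    have hcoord : ∀ i : Fin n, ContDiff ℝ ∞ fun y : EuclideanSpace ℝ (Fin n) => y i := fun i =>
      (EuclideanSpace.proj (𝕜 := ℝ) i).contDiff
    have hξc : ContDiff ℝ ∞ (sqSumLT (m := n) (lam p)) := by
      show ContDiff ℝ ∞ fun u : EuclideanSpace ℝ (Fin n) =>
        ∑ i ∈ Finset.univ.filter (fun i : Fin n => (i : ℕ) < lam p), (u i) ^ 2
      exact ContDiff.sum fun i _ => (hcoord i).pow 2
    have hinv : ContDiffOn ℝ ∞ (fun z => (2 * sqSumLT (lam p) (e p z))⁻¹)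
        ((e p).source ∩ (e p) ⁻¹' {y | ε / 2 < sqSumLT (lam p) y}) := by
      refine (contDiffOn_const.mul (hξc.comp_contDiffOn he_c)).inv fun z hz => ?_
      have : ε / 2 < sqSumLT (lam p) (e p z) := hz.2
      exact mul_ne_zero two_ne_zero (by linarith : sqSumLT (lam p) (e p z) ≠ 0)
    -- `z ↦ De⁻¹(e z) (w(e z))`
    have hD : ContDiffOn ℝ ∞ (fderiv ℝ (e p).symm) (e p).target :=
      (hsymm p hp).fderiv_of_isOpen (e p).open_target (by simp)
    have hmvc : ContDiff ℝ ∞ (fun y : EuclideanSpace ℝ (Fin n) => milnorModelField (lam p) y) := by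
      refine contDiff_euclidean.2 fun i => ?_
      by_cases hi : (i : ℕ) < lam p
      · have : (fun y : EuclideanSpace ℝ (Fin n) => milnorModelField (lam p) y i) = fun y => -(y i) := by
          funext y; rw [milnorModelField_apply, if_pos hi]
        rw [this]; exact (hcoord i).neg
      · have : (fun y : EuclideanSpace ℝ (Fin n) => milnorModelField (lam p) y i) = fun y => y i := by
          funext y; rw [milnorModelField_apply, if_neg hi]
        rw [this]; exact hcoord i
    have hw : ContDiff ℝ ∞ (fun y : EuclideanSpace ℝ (Fin n) =>
        (1 / 2 : ℝ) • (y - milnorModelField (lam p) y)) :=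
      (contDiff_id.sub hmvc).const_smul (1 / 2 : ℝ)
    have happ : ContDiffOn ℝ ∞ (fun z => fderiv ℝ (e p).symm (e p z)
        ((1 / 2 : ℝ) • (e p z - milnorModelField (lam p) (e p z))))
        ((e p).source ∩ (e p) ⁻¹' {y | ε / 2 < sqSumLT (lam p) y}) :=
      (hD.comp he_c hmaps).clm_apply (hw.comp_contDiffOn he_c)
    exact hinv.smul happ
  -- `df(V_p z) = -1` on the chart domain away from `x⃗ = 0`
  have hVdf : ∀ p ∈ P, ∀ z ∈ (e p).source, sqSumLT (lam p) (e p z) ≠ 0 →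
      fderiv ℝ f z (V p z) = -1 := by
    intro p hp z hz hξ
    have hyt : e p z ∈ (e p).target := (e p).map_source hz
    have hsd : DifferentiableAt ℝ (e p).symm (e p z) :=
      ((hsymm p hp).contDiffAt ((e p).open_target.mem_nhds hyt)).differentiableAt (by simp)
    have hchain : ∀ w, fderiv ℝ f z (fderiv ℝ (e p).symm (e p z) w) =
        fderiv ℝ (f ∘ (e p).symm) (e p z) w := fun w => by
      rw [fderiv_comp _ (by rw [(e p).left_inv hz]; exact hfd _) hsd, ContinuousLinearMap.comp_apply,
        (e p).left_inv hz]
    rw [hV]; dsimp only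
    rw [map_smul, hchain, map_smul, fderiv_comp_symm_sub_milnorModelField (e p) (hquad p hp) hyt,
      smul_eq_mul, smul_eq_mul]
    field_simp
    ring
  -- ### the field `B`
  set B : EuclideanSpace ℝ (Fin n) → EuclideanSpace ℝ (Fin n) := fun z =>
    ∑ p ∈ P, χ p z • (V p z + Ξ z) with hB
  have hBc : ContDiff ℝ ∞ B := by
    refine ContDiff.sum fun p hp => ?_
    have hO : IsOpen (((e p).source ∩ (e p) ⁻¹' {y | ε / 2 < sqSumLT (lam p) y}) ∩ {z | fderiv ℝ f z ≠ 0}) :=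
      ((e p).isOpen_inter_preimage (isOpen_lt continuous_const (continuous_sqSumLT _))).inter
        (isOpen_ne_fun hfcont continuous_const)
    refine contDiff_smul_of_tsupport_subset_aux hO (((hVc p hp).mono inter_subset_left).add
      (hΞc.mono inter_subset_right)) (hχc p hp) ?_
    intro z hz
    have h := hχN p hp hz
    exact ⟨⟨h.1.2.1, (h.1.2.2).2⟩, h.2⟩
  have hBcs : HasCompactSupport B := by
    have hK : IsCompact (⋃ p ∈ P, tsupport (χ p)) :=
      P.isCompact_biUnion fun p hp => hχcs p hp
    have hsub : support B ⊆ ⋃ p ∈ P, tsupport (χ p) := by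
      intro z hz
      rw [mem_support] at hz
      by_contra hcon
      apply hz
      rw [hB]; dsimp only
      refine Finset.sum_eq_zero fun p hp => ?_
      have : χ p z = 0 := by
        by_contra h
        exact hcon (mem_iUnion₂.2 ⟨p, hp, subset_tsupport _ h⟩)
      rw [this, zero_smul]
    show IsCompact (tsupport B)
    exact hK.of_isClosed_subset (isClosed_tsupport B)
      (closure_minimal hsub (isClosed_biUnion_finset fun p _ => isClosed_tsupport _))
  have htan : ∀ z, fderiv ℝ f z (B z) = 0 := by
    intro z
    rw [hB]; dsimp only
    rw [map_sum]
    refine Finset.sum_eq_zero fun p hp => ?_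
    by_cases hz : χ p z = 0
    · rw [hz, zero_smul, map_zero]
    · have hzN : z ∈ N p := hχN p hp (subset_tsupport _ hz)
      have hξ : sqSumLT (lam p) (e p z) ≠ 0 := by
        have : ε / 2 < sqSumLT (lam p) (e p z) := hzN.1.2.2.2
        linarith
      rw [map_smul, map_add, hVdf p hp z hzN.1.2.1 hξ, hΞdf z hzN.2, smul_eq_mul]
      ring
  -- ### the shear
  obtain ⟨Λ, hfΛ, hfix, hfix', hDΛ⟩ := exists_shear_diffeomorph hf (c - ε) hBc hBcs htan
  have hBU : ∀ z, B z ≠ 0 → z ∈ U := by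
    intro z hz
    by_contra hzU
    apply hz
    rw [hB]; dsimp only
    refine Finset.sum_eq_zero fun p hp => ?_
    have : χ p z = 0 := by
      by_contra h
      exact hzU (hχN p hp (subset_tsupport _ h)).1.1
    rw [this, zero_smul]
  have hBp : ∀ p ∈ P, B p = 0 := by
    intro p hp
    rw [hB]; dsimp only
    refine Finset.sum_eq_zero fun q hq => ?_
    have : χ q p = 0 := by
      by_contra h
      have hpN : p ∈ N q := hχN q hq (subset_tsupport _ h)
      by_cases hqp : q = p
      · subst hqp
        have : ε / 2 < sqSumLT (lam q) (e q q) := hpN.1.2.2.2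
        rw [(hpe q hq).2] at this
        have h0 : sqSumLT (lam q) (0 : EuclideanSpace ℝ (Fin n)) = 0 :=
          Finset.sum_eq_zero fun i _ => by simp
        linarith
      · -- `p` lies in its own closed chart ball, disjoint from `q`'s
        have h1 : p ∈ (e q).symm '' closedBall (0 : EuclideanSpace ℝ (Fin n)) R :=
          ⟨e q p, ball_subset_closedBall hpN.1.2.2.1, (e q).left_inv hpN.1.2.1⟩
        have h2 : p ∈ (e p).symm '' closedBall (0 : EuclideanSpace ℝ (Fin n)) R := by
          refine ⟨0, mem_closedBall_self hR.le, ?_⟩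
          rw [← (hpe p hp).2, (e p).left_inv (hpe p hp).1]
        exact Set.disjoint_left.1 (hdisj q hq p hp hqp) h1 h2
    rw [this, zero_smul]
  refine ⟨Λ, hfΛ, fun z hz => hfix z (Or.inl hz), fun z hz => ?_, fun p hp => ?_, ?_⟩
  · have hB0 : B z = 0 := by by_contra h; exact hz (hBU z h)
    exact ⟨hfix z (Or.inr hB0), hfix' z (Or.inr hB0)⟩
  · exact ⟨hfix p (Or.inr (hBp p hp)), hfix' p (Or.inr (hBp p hp))⟩
  · -- ### orthogonality along the spheres
    intro p hp y hy0 hyξ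
    obtain ⟨hyb, hyt⟩ := hSball p hp y hy0 hyξ
    set s := (e p).symm y with hs
    have hsS : s ∈ S p := ⟨y, ⟨hy0, hyξ⟩, rfl⟩
    have hsrc : s ∈ (e p).source := (e p).map_target hyt
    have hes : e p s = y := (e p).right_inv hyt
    have hfs : f s = c - ε := hfS p hp y hy0 hyξ
    have hsd : DifferentiableAt ℝ (e p).symm y :=
      ((hsymm p hp).contDiffAt ((e p).open_target.mem_nhds hyt)).differentiableAt (by simp)
    -- `B s = V_p s + Ξ s`
    have hχps : χ p s = 1 := (hχ1 p hp s hsS).self_of_nhds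
    have hχqs : ∀ q ∈ P, q ≠ p → χ q s = 0 := by
      intro q hq hqp
      by_contra h
      have hsN : s ∈ N q := hχN q hq (subset_tsupport _ h)
      have h1 : s ∈ (e q).symm '' closedBall (0 : EuclideanSpace ℝ (Fin n)) R :=
        ⟨e q s, ball_subset_closedBall hsN.1.2.2.1, (e q).left_inv hsN.1.2.1⟩
      have h2 : s ∈ (e p).symm '' closedBall (0 : EuclideanSpace ℝ (Fin n)) R :=
        ⟨y, ball_subset_closedBall hyb, rfl⟩
      exact Set.disjoint_left.1 (hdisj q hq p hp hqp) h1 h2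
    have hBs : B s = V p s + Ξ s := by
      rw [hB]; dsimp only
      rw [Finset.sum_eq_single p (fun q hq hqp => by rw [hχqs q hq hqp, zero_smul])
        (fun h => absurd hp h), hχps, one_smul]
    -- the derivative of `Λ ∘ e⁻¹` at `y`
    have hΛ' := hDΛ s hfs
    have hcomp : HasFDerivAt (Λ ∘ (e p).symm)
        ((ContinuousLinearMap.id ℝ _ + (fderiv ℝ f s).smulRight (B s)).comp
          (fderiv ℝ (e p).symm y)) y := by
      have h := hΛ'.comp y (hsd.hasFDerivAt)
      exact h
    rw [hcomp.fderiv, ContinuousLinearMap.comp_apply]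
    have hDψw : fderiv ℝ (e p).symm y (y - milnorModelField (lam p) y) = (4 * ε) • V p s := by
      rw [hV]; dsimp only
      rw [hes, hyξ, map_smul, smul_smul, smul_smul]
      have hsc : (4 * ε * (2 * ε)⁻¹ * (1 / 2) : ℝ) = 1 := by
        rw [show (4 : ℝ) * ε = 2 * (2 * ε) by ring, mul_assoc 2 (2 * ε),
          mul_inv_cancel₀ (by positivity : (2 : ℝ) * ε ≠ 0)]
        norm_num
      rw [hsc, one_smul]
    have hdfw : fderiv ℝ f s (fderiv ℝ (e p).symm y (y - milnorModelField (lam p) y)) = -(4 * ε) := by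
      have h := fderiv_comp_symm_sub_milnorModelField (e p) (hquad p hp) hyt
      rw [fderiv_comp y (hfd _) hsd, ContinuousLinearMap.comp_apply] at h
      rw [h, hyξ]; ring
    show fderiv ℝ (e p).symm y (y - milnorModelField (lam p) y) +
        fderiv ℝ f s (fderiv ℝ (e p).symm y (y - milnorModelField (lam p) y)) • B s = _
    rw [hdfw, hDψw, hBs, smul_add, neg_smul, neg_smul]
    have e1 : (4 * ε) • V p s + (-((4 * ε) • V p s) + -((4 * ε) • Ξ s)) = -((4 * ε) • Ξ s) := by abel
    rw [e1, hΞ]; dsimp only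
    rw [hgrad_eq s, smul_smul, ← neg_smul, div_eq_mul_inv]

end Shear

end Literature.Geometry.Riemannian

end
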